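import Summits.BirchSwinnertonDyer.BirchSwinnertonDyer.Theorems.AlignedTransportAtTwoMainConjectureOfRankZeroBSDAtTwoCyclotomicLayerPrime
import Literature.NumberTheory.EllipticCurves.IwasawaAlgebraEisensteinUniformIndexProofs
import HarnessLib

/-!
# Route `AlignedTransportAtTwo`, crux C2 `MainConjectureOfRankZeroBSDAtTwo` (stmt-BirchSwinnertonDyer-22298):
# THE LAYER-GROWTH NUMBER IS AN INDEX, I — THE LAYER RING: `Λ` modulo an EISENSTEIN distinguished polynomial `g` (`g(0) = p`, `g` prime in `Λ`;
# e.g. the layer polynomial `Ψ_n = Φ_{p^{n+1}}(1+T)`) is a discrete valuation ring with uniformiser `π = T mod g` and residue field `𝔽_p`,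
# so `#N = p^{length N}` for every finite module over it

HONEST FRAMING (cell `bsd-f1-sign2`, WIDTH-5 attached prover seat `bsd-line-att-p5` gen 54 on line `birth` of the lead `bsd-line-att-p2`;
`--supports` stmt-BirchSwinnertonDyer-22298, closes nothing; BSD is NOT proved by any of this; the crux C2, its verdict «blocked-on
`Rank1Residual.GreenbergMuConjectureIrreducible`» and every registered stub (P / T / Kμ / LimDoor / MuIneqʳ / PFμ⁺) are untouched). THEOREMS ONLY —
pure commutative algebra over `Λ = ℤ_p⟦T⟧`, any prime `p`; no `def`, no instance, no named fact, no `sorry`. Lineage glue on g53's successor (1)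
(`LAYER-LAW-att-p5-g53.md` §5, «the bridge `|f_X(ζ−1)|^{2ⁿ} = 2^{−growth}`», kernel half): g53 reads the LAYER-GROWTH NUMBER `φ(p^{n+1})·μ(F) + λ(F)` off ONE
value `|F(ζ−1)|`; this gen reads the same number as a MODULE INDEX — the order of the layer quotient `X/Ψ_n X` — in three files: THIS FILE (the layer ring
`𝒪_n = Λ/(Ψ_n)`), `…HalfDescentLayerIndex` (the cyclic index `#Λ/(F, Ψ_n) = p^{φμ+λ}`), `…HalfDescentLayerIndexModule` (`#(X/Ψ_n X)` for `X` without finite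
submodule, by Fulton's `length = ord(det)` over the one-dimensional local domain `𝒪_n` — which is why `𝒪_n` must be KNOWN to be a DVR with residue field `𝔽_p`).

THE POINT. `Ψ_n = Φ_{p^{n+1}}(1+T) ∈ ℤ_p[T]` is an EISENSTEIN distinguished polynomial: monic of degree `φ(p^{n+1}) = pⁿ(p−1)`, lower coefficients in `(p)`,
constant coefficient EXACTLY `p` (tree `DefectPrime.constantCoeff_coe_cyclotomic_comp`), prime in `Λ` (`DefectPrime.prime_coe_cyclotomic_comp`). Everything
below is written for ANY such `g ∈ ℤ_p[T]` (hypotheses `hg0 : g(0) = p` and `hgp : g` prime in `Λ`; Howard's `q_m = T^m + p` of the tree's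
`IwasawaAlgebraEisensteinQuotientDVRProofs` is the other instance and the proofs are the same, mutatis mutandis `p = g − T·h` for `p = q_m − T^m`):
`𝒪 = Λ/(g)` is a domain, local, `π = T mod g` is a non-zero non-unit (`g ∤ T`; `T·a − 1 ∈ (g)` is absurd at `T = 0`), ★ **`𝔪_𝒪 = (π)`**
(`maximalIdeal_quotient_eq_span_mk_X`: a non-unit `a mod g` has `a(0) ∈ pℤ_p`, and `p ≡ −T·h`), hence ★★ **`𝒪` is a DISCRETE VALUATION RING**
(`isDiscreteValuationRing_quotient`, Mathlib `IsDiscreteValuationRing.TFAE`); `(g, T) = (T, p)` so **`#κ(𝒪) = p`** (`natCard_residueField_quotient`) and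
★ **`#N = p^{length_𝒪 N}`** for every `𝒪`-module of finite length (`natCard_eq_pow_length_quotient`, the tree's `Module.natCard_eq_natCard_residueField_pow_length`).
For `g = Ψ_n`: `𝒪_n ≅ ℤ_p[ζ_{p^{n+1}}]`, `π ↔ ζ − 1`, totally ramified of degree `φ(p^{n+1})`. Memo `Cruxes/MainConjectureOfRankZeroBSDAtTwo/LAYER-INDEX-att-p5-g54.md`.
BSD is not proved by any of this; nothing about any curve is asserted here.

References: J.-P. Serre, *Local Fields*, I §6 (Eisenstein equations give totally ramified DVRs) [SerreLocalFields1979]; L. Washington, GTM 83, §7.1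
(Prop. 7.2, Thm. 7.3), §13.2 (Lemma 13.7, Prop. 13.8) [Washington1997]; B. Howard, Compositio 140 (2004) §2.2 (`S_𝔮 = Λ/𝔮` a DVR) [Howard2004HeegnerKolyvagin].
-/

set_option linter.dupNamespace false
set_option autoImplicit false

noncomputable section

open scoped Classical Polynomial

namespace Summit.BirchSwinnertonDyer.BirchSwinnertonDyer.Theorems.AlignedTransportAtTwoHalfDescentLayerRing

open Literature.NumberTheory.EllipticCurves Literature.NumberTheory.EllipticCurves.IwasawaAlgebra
  Summit.BirchSwinnertonDyer.Rank1Residual.X1.MuLambda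
  Summit.BirchSwinnertonDyer.Rank1Residual.Iwasawa
  Summit.BirchSwinnertonDyer.BirchSwinnertonDyer.Theorems.DefectPrime
  Summit.BirchSwinnertonDyer.BirchSwinnertonDyer.Theorems.AlignedTransportAtTwoCyclotomicLayerPrime

universe v

variable {p : ℕ} [hp : Fact p.Prime]

/-! ## §1 `Λ` modulo an Eisenstein distinguished polynomial `g` (`g(0) = p`, `g` prime in `Λ`): a DVR with uniformiser `T mod g` and residue field `𝔽_p` -/

section Eisenstein

variable {g : ℤ_[p][X]}

/-- `𝒪 = Λ/(g)` is a domain for `g` prime in `Λ`. [cite: Washington1997, §13.2] -/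
theorem isDomain_quotient (hgp : Prime (g : IwasawaAlgebra p)) : IsDomain (IwasawaAlgebra p ⧸ Ideal.span {(g : IwasawaAlgebra p)}) := by
  haveI : (Ideal.span {(g : IwasawaAlgebra p)}).IsPrime := (Ideal.span_singleton_prime hgp.ne_zero).mpr hgp
  exact Ideal.Quotient.isDomain _

/-- `𝒪 = Λ/(g)` is non-trivial for `g` prime in `Λ` (`g` is not a unit). [cite: Washington1997, §7.1] -/
theorem nontrivial_quotient (hgp : Prime (g : IwasawaAlgebra p)) : Nontrivial (IwasawaAlgebra p ⧸ Ideal.span {(g : IwasawaAlgebra p)}) :=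
  Ideal.Quotient.nontrivial_iff.mpr (by rw [Ne, Ideal.span_singleton_eq_top]; exact hgp.not_unit)

/-- `𝒪 = Λ/(g)` is a local ring (a non-trivial quotient of the local ring `Λ`). [cite: Washington1997, §13.2] -/
theorem isLocalRing_quotient (hgp : Prime (g : IwasawaAlgebra p)) : IsLocalRing (IwasawaAlgebra p ⧸ Ideal.span {(g : IwasawaAlgebra p)}) := by
  haveI := nontrivial_quotient hgp
  exact IsLocalRing.of_surjective' (Ideal.Quotient.mk _) Ideal.Quotient.mk_surjective

/-- `g = T·h + p` in `Λ` when `g(0) = p`. [cite: Washington1997, §7.1] -/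
theorem exists_coe_eq_X_mul_add_C (hg0 : PowerSeries.constantCoeff (g : IwasawaAlgebra p) = p) :
    ∃ h : IwasawaAlgebra p, (g : IwasawaAlgebra p) = PowerSeries.X * h + PowerSeries.C (p : ℤ_[p]) := by
  have hdvd : (PowerSeries.X : IwasawaAlgebra p) ∣ (g : IwasawaAlgebra p) - PowerSeries.C (p : ℤ_[p]) := by
    rw [PowerSeries.X_dvd_iff, map_sub, PowerSeries.constantCoeff_C, hg0, sub_self]
  obtain ⟨h, hh⟩ := hdvd
  exact ⟨h, by rw [← hh]; ring⟩

/-- `g ∤ T` in `Λ` (`g(0) = p`, `g` prime): else `T = g·q` forces `q(0) = 0`, `q = T·q'`, `1 = g·q'`. [cite: Washington1997, §7.1] -/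
theorem not_coe_dvd_X (hg0 : PowerSeries.constantCoeff (g : IwasawaAlgebra p) = p) (hgp : Prime (g : IwasawaAlgebra p)) : ¬ (g : IwasawaAlgebra p) ∣ PowerSeries.X := by
  rintro ⟨q, hq⟩
  have h0 := congrArg PowerSeries.constantCoeff hq
  rw [PowerSeries.constantCoeff_X, map_mul, hg0] at h0
  have hq0 : PowerSeries.constantCoeff q = 0 := by
    rcases mul_eq_zero.mp h0.symm with h | h
    · exact absurd h (Nat.cast_ne_zero.mpr hp.out.ne_zero)
    · exact h
  obtain ⟨q', hq'⟩ := (PowerSeries.X_dvd_iff).mpr hq0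
  have h1 : (PowerSeries.X : IwasawaAlgebra p) * (1 - (g : IwasawaAlgebra p) * q') = 0 := by
    rw [mul_sub, mul_one, sub_eq_zero]
    conv_lhs => rw [hq, hq']
    ring
  rcases mul_eq_zero.mp h1 with h | h
  · exact PowerSeries.X_ne_zero h
  · exact hgp.not_unit (IsUnit.of_mul_eq_one q' (sub_eq_zero.mp h).symm)

/-- `π = T mod g` is non-zero in `𝒪`. [cite: Washington1997, §7.1] -/
theorem mk_X_ne_zero (hg0 : PowerSeries.constantCoeff (g : IwasawaAlgebra p) = p) (hgp : Prime (g : IwasawaAlgebra p)) :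
    Ideal.Quotient.mk (Ideal.span {(g : IwasawaAlgebra p)}) PowerSeries.X ≠ 0 := by
  rw [Ne, Ideal.Quotient.eq_zero_iff_mem, Ideal.mem_span_singleton]
  exact not_coe_dvd_X hg0 hgp

/-- `π = T mod g` is not a unit of `𝒪`: a relation `T·a − 1 ∈ (g)` is impossible (constant coefficients: `−1 = p·b₀`). [cite: Washington1997, §7.1] -/
theorem not_isUnit_mk_X (hg0 : PowerSeries.constantCoeff (g : IwasawaAlgebra p) = p) :
    ¬ IsUnit (Ideal.Quotient.mk (Ideal.span {(g : IwasawaAlgebra p)}) PowerSeries.X) := by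
  intro hu
  obtain ⟨v, hv⟩ := IsUnit.exists_right_inv hu
  obtain ⟨a, rfl⟩ := Ideal.Quotient.mk_surjective v
  rw [← map_mul, ← (Ideal.Quotient.mk _).map_one, Ideal.Quotient.eq, Ideal.mem_span_singleton] at hv
  obtain ⟨b, hb⟩ := hv
  have h0 := congrArg PowerSeries.constantCoeff hb
  rw [map_sub, map_mul, PowerSeries.constantCoeff_X, zero_mul, map_one, map_mul, hg0] at h0
  have h1 : (p : ℤ_[p]) * (-PowerSeries.constantCoeff b) = 1 := by linear_combination h0
  exact PadicInt.irreducible_p.not_isUnit (IsUnit.of_mul_eq_one _ h1)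

/-- **The maximal ideal of `𝒪 = Λ/(g)` is `(π)`, `π = T mod g`**: a non-unit `a mod g` has `a(0) ∈ pℤ_p` (else `a = unit + T·a'` is a unit of the local
ring `𝒪`), and `p = g − T·h ≡ −T·h (mod g)`, so `a ≡ T·(a' − h·b) ∈ (π)`. [cite: Howard2004HeegnerKolyvagin, §2.2 (S_𝔮 a discrete valuation ring)]
[cite: SerreLocalFields1979, I §6] -/
theorem maximalIdeal_quotient_eq_span_mk_X (hg0 : PowerSeries.constantCoeff (g : IwasawaAlgebra p) = p) (hgp : Prime (g : IwasawaAlgebra p)) :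
    @IsLocalRing.maximalIdeal _ _ (isLocalRing_quotient hgp) =
      Ideal.span {Ideal.Quotient.mk (Ideal.span {(g : IwasawaAlgebra p)}) PowerSeries.X} := by
  letI := isLocalRing_quotient hgp
  obtain ⟨h, hh⟩ := exists_coe_eq_X_mul_add_C (p := p) hg0
  apply le_antisymm
  · intro s hs
    rw [IsLocalRing.mem_maximalIdeal, mem_nonunits_iff] at hs
    obtain ⟨a, rfl⟩ := Ideal.Quotient.mk_surjective s
    obtain ⟨a', ha'⟩ : ∃ a' : IwasawaAlgebra p, a = PowerSeries.C (PowerSeries.constantCoeff a) + PowerSeries.X * a' := by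
      have hdvd : (PowerSeries.X : IwasawaAlgebra p) ∣ a - PowerSeries.C (PowerSeries.constantCoeff a) := by
        rw [PowerSeries.X_dvd_iff, map_sub, PowerSeries.constantCoeff_C, sub_self]
      obtain ⟨a', h'⟩ := hdvd
      exact ⟨a', by rw [← h']; ring⟩
    have ha0 : ¬ IsUnit (PowerSeries.constantCoeff a) := by
      intro hu
      apply hs
      have hXmem : Ideal.Quotient.mk (Ideal.span {(g : IwasawaAlgebra p)}) (PowerSeries.X * a') ∈ IsLocalRing.maximalIdeal _ := by
        rw [map_mul]
        exact Ideal.mul_mem_right _ _ ((IsLocalRing.mem_maximalIdeal _).mpr (not_isUnit_mk_X hg0))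
      have hCunit : IsUnit (Ideal.Quotient.mk (Ideal.span {(g : IwasawaAlgebra p)}) (PowerSeries.C (PowerSeries.constantCoeff a))) :=
        (hu.map PowerSeries.C).map _
      by_contra hnot
      have hmem : Ideal.Quotient.mk _ a ∈ IsLocalRing.maximalIdeal _ := (IsLocalRing.mem_maximalIdeal _).mpr hnot
      rw [ha', map_add] at hmem
      have hC := Submodule.sub_mem _ hmem hXmem
      rw [add_sub_cancel_right] at hC
      exact (IsLocalRing.mem_maximalIdeal _).mp hC hCunit
    have ha0' : PowerSeries.constantCoeff a ∈ IsLocalRing.maximalIdeal ℤ_[p] := (IsLocalRing.mem_maximalIdeal _).mpr ha0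
    rw [PadicInt.maximalIdeal_eq_span_p, Ideal.mem_span_singleton] at ha0'
    obtain ⟨b, hb⟩ := ha0'
    -- `C a₀ = C p * C b = (g − X h) * C b ≡ −X h C b (mod g)`
    rw [Ideal.mem_span_singleton]
    refine ⟨Ideal.Quotient.mk _ (a' - h * PowerSeries.C b), ?_⟩
    rw [← map_mul, Ideal.Quotient.eq, Ideal.mem_span_singleton]
    refine ⟨PowerSeries.C b, ?_⟩
    have hCp : (PowerSeries.C (p : ℤ_[p]) : IwasawaAlgebra p) = (g : IwasawaAlgebra p) - PowerSeries.X * h := by rw [hh]; ring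
    rw [ha', hb, map_mul, hCp]
    ring
  · rw [Ideal.span_singleton_le_iff_mem]
    exact (IsLocalRing.mem_maximalIdeal _).mpr (not_isUnit_mk_X hg0)

/-- `𝒪 = Λ/(g)` is not a field (`π ≠ 0` lies in the maximal ideal). [cite: Washington1997, §13.2] -/
theorem not_isField_quotient (hg0 : PowerSeries.constantCoeff (g : IwasawaAlgebra p) = p) (hgp : Prime (g : IwasawaAlgebra p)) :
    ¬ IsField (IwasawaAlgebra p ⧸ Ideal.span {(g : IwasawaAlgebra p)}) := by
  letI := isLocalRing_quotient hgp
  rw [IsLocalRing.isField_iff_maximalIdeal_eq, maximalIdeal_quotient_eq_span_mk_X hg0 hgp, Ideal.span_singleton_eq_bot]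
  exact mk_X_ne_zero hg0 hgp

/-- **`𝒪 = Λ/(g) = ℤ_p[π]` is a discrete valuation ring** for an Eisenstein distinguished `g` prime in `Λ`: a Noetherian local domain, not a field, with
principal maximal ideal `(π)` (Mathlib `IsDiscreteValuationRing.TFAE`). [cite: SerreLocalFields1979, I §6] [cite: Howard2004HeegnerKolyvagin, §2.2] -/
theorem isDiscreteValuationRing_quotient (hg0 : PowerSeries.constantCoeff (g : IwasawaAlgebra p) = p) (hgp : Prime (g : IwasawaAlgebra p)) :
    @IsDiscreteValuationRing (IwasawaAlgebra p ⧸ Ideal.span {(g : IwasawaAlgebra p)}) _ (isDomain_quotient hgp) := by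
  letI := isDomain_quotient hgp
  letI := isLocalRing_quotient hgp
  have h := IsDiscreteValuationRing.TFAE (IwasawaAlgebra p ⧸ Ideal.span {(g : IwasawaAlgebra p)}) (not_isField_quotient hg0 hgp)
  refine (h.out 0 4).mpr ?_
  rw [maximalIdeal_quotient_eq_span_mk_X hg0 hgp]
  exact ⟨⟨_, rfl⟩⟩

/-- `(g, T) = (T, p)` in `Λ` when `g(0) = p` (`g − p ∈ (T)`). [cite: Washington1997, §7.1] -/
theorem span_coe_sup_span_X_eq (hg0 : PowerSeries.constantCoeff (g : IwasawaAlgebra p) = p) :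
    Ideal.span {(g : IwasawaAlgebra p)} ⊔ Ideal.span {(PowerSeries.X : IwasawaAlgebra p)} =
      Ideal.span {(PowerSeries.X : IwasawaAlgebra p)} ⊔ Ideal.span {PowerSeries.C ((p : ℤ_[p]) ^ 1)} := by
  rw [pow_one]
  obtain ⟨h, hh⟩ := exists_coe_eq_X_mul_add_C (p := p) hg0
  have hXh : PowerSeries.X * h ∈ Ideal.span {(PowerSeries.X : IwasawaAlgebra p)} :=
    Ideal.mem_span_singleton.mpr (dvd_mul_right _ _)
  apply le_antisymm
  · refine sup_le ?_ le_sup_left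
    rw [Ideal.span_singleton_le_iff_mem, hh]
    exact Submodule.add_mem _ (Ideal.mem_sup_left hXh) (Ideal.mem_sup_right (Ideal.mem_span_singleton_self _))
  · refine sup_le le_sup_right ?_
    rw [Ideal.span_singleton_le_iff_mem]
    have hmem : (g : IwasawaAlgebra p) - PowerSeries.X * h ∈ Ideal.span {(g : IwasawaAlgebra p)} ⊔ Ideal.span {(PowerSeries.X : IwasawaAlgebra p)} :=
      Submodule.sub_mem _ (Ideal.mem_sup_left (Ideal.mem_span_singleton_self _)) (Ideal.mem_sup_right hXh)
    have e : (g : IwasawaAlgebra p) - PowerSeries.X * h = PowerSeries.C (p : ℤ_[p]) := by rw [hh]; ring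
    rwa [e] at hmem

/-- `#(Λ/(g, T)) = p` (`= #(Λ/(T, p)) = #𝔽_p`). [cite: Washington1997, §7.1 and Prop. 13.8] -/
theorem natCard_quotient_span_coe_sup_span_X (hg0 : PowerSeries.constantCoeff (g : IwasawaAlgebra p) = p) :
    Nat.card (IwasawaAlgebra p ⧸ (Ideal.span {(g : IwasawaAlgebra p)} ⊔ Ideal.span {(PowerSeries.X : IwasawaAlgebra p)})) = p := by
  rw [span_coe_sup_span_X_eq hg0]
  have hX := isDistinguishedAt_X p
  haveI := free_quotient_pow p hX 1
  haveI := finite_quotient_pow p hX 1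
  have h1 : Ideal.span {(PowerSeries.X : IwasawaAlgebra p)} = Ideal.span {((Polynomial.X : ℤ_[p][X]) : IwasawaAlgebra p) ^ 1} := by
    rw [pow_one, Polynomial.coe_X]
  rw [h1, card_quotient_sup_span_C_pow, finrank_quotient_pow p hX 1, Polynomial.natDegree_X, one_mul, mul_one, pow_one]

/-- `#(𝒪/(π)) = p`. [cite: SerreLocalFields1979, I §6] [cite: Washington1997, Prop. 13.8] -/
theorem natCard_quotient_span_mk_X (hg0 : PowerSeries.constantCoeff (g : IwasawaAlgebra p) = p) :
    Nat.card ((IwasawaAlgebra p ⧸ Ideal.span {(g : IwasawaAlgebra p)}) ⧸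
      Ideal.span {Ideal.Quotient.mk (Ideal.span {(g : IwasawaAlgebra p)}) PowerSeries.X}) = p := by
  rw [natCard_quotient_span_mk_eq_natCard_quotient_sup, sup_comm]
  exact natCard_quotient_span_coe_sup_span_X hg0

/-- **The residue field of `𝒪 = Λ/(g)` has `p` elements** (`𝒪/ℤ_p` is totally ramified: `κ(𝒪) = 𝒪/(π) = Λ/(T, p) = 𝔽_p`). [cite: SerreLocalFields1979, I §6] -/
theorem natCard_residueField_quotient (hg0 : PowerSeries.constantCoeff (g : IwasawaAlgebra p) = p) (hgp : Prime (g : IwasawaAlgebra p)) :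
    Nat.card (@IsLocalRing.ResidueField _ _ (isLocalRing_quotient hgp)) = p := by
  letI := isLocalRing_quotient hgp
  change Nat.card ((IwasawaAlgebra p ⧸ Ideal.span {(g : IwasawaAlgebra p)}) ⧸ IsLocalRing.maximalIdeal _) = p
  rw [Nat.card_congr (Ideal.quotEquivOfEq (maximalIdeal_quotient_eq_span_mk_X hg0 hgp)).toEquiv]
  exact natCard_quotient_span_mk_X hg0

/-- **`#N = p^{length_𝒪 N}` for every `𝒪`-module `N` of finite length**, `𝒪 = Λ/(g)` (composition series; every simple `𝒪`-module is `κ(𝒪) = 𝔽_p`).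
[cite: Washington1997, §13.2 (lengths and orders of finite Λ-modules)] -/
theorem natCard_eq_pow_length_quotient (hg0 : PowerSeries.constantCoeff (g : IwasawaAlgebra p) = p) (hgp : Prime (g : IwasawaAlgebra p)) {N : Type v} [AddCommGroup N]
    [Module (IwasawaAlgebra p ⧸ Ideal.span {(g : IwasawaAlgebra p)}) N] (hN : IsFiniteLength (IwasawaAlgebra p ⧸ Ideal.span {(g : IwasawaAlgebra p)}) N) :
    Nat.card N = p ^ (Module.length (IwasawaAlgebra p ⧸ Ideal.span {(g : IwasawaAlgebra p)}) N).toNat := by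
  letI := isLocalRing_quotient hgp
  rw [Module.natCard_eq_natCard_residueField_pow_length hN, natCard_residueField_quotient hg0 hgp]

/-- `#N = p^{length_𝒪 N}` for every FINITE `𝒪`-module `N`. [cite: Washington1997, §13.2 (lengths and orders of finite Λ-modules)] -/
theorem natCard_eq_pow_length_quotient_of_finite (hg0 : PowerSeries.constantCoeff (g : IwasawaAlgebra p) = p) (hgp : Prime (g : IwasawaAlgebra p)) {N : Type v} [AddCommGroup N]
    [Module (IwasawaAlgebra p ⧸ Ideal.span {(g : IwasawaAlgebra p)}) N] [Finite N] :
    Nat.card N = p ^ (Module.length (IwasawaAlgebra p ⧸ Ideal.span {(g : IwasawaAlgebra p)}) N).toNat :=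
  natCard_eq_pow_length_quotient hg0 hgp Module.isFiniteLength_of_finite

end Eisenstein

end Summit.BirchSwinnertonDyer.BirchSwinnertonDyer.Theorems.AlignedTransportAtTwoHalfDescentLayerRing

end
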